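import Summits.AtomisticToContinuum.BoseEinsteinCondensation.Theorems.BECCutLineWeakDisorderGroundStateRigidityStubFiniteEnergyLowDensity
import Summits.AtomisticToContinuum.BoseEinsteinCondensation.Theorems.BECCutLineWeakDisorderGroundStateRigidityStubExistsNonnegGroundState
import Summits.AtomisticToContinuum.BoseEinsteinCondensation.Theorems.BECCutLineWeakDisorderGroundStateRigidityStubCompactness
import Literature.MathematicalPhysics.QuantumManyBody.BoseGasThermodynamicLimitProofs
import Literature.MathematicalPhysics.QuantumManyBody.GroundState
import HarnessLib

/-!
# Route `BECHeatBathGap`, crux `SquareSummableInfluence` (stmt-AtomisticToContinuum-14368), line `registered`: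
# the ground states quantified in the physics kernel EXIST

Supports (does not close) stmt-AtomisticToContinuum-14368 (lead c1). The physics kernel of the line
(`stub_groundStateInfluence`, skeleton v2) begins `∃ Θ₀ Ψ₀, IsGroundState v L' Θ₀ ∧ IsGroundState v L' Ψ₀ ∧ …`
with `L' = sideLength ρ (N+1)`, `Θ₀` an `N`-body and `Ψ₀` an `(N+1)`-body closed-form ground state. This file
records that the two existential clauses are NOT the obstacle: for every repulsive finite-range `v`, at low
density and eventually in `N`, both ground states exist (`eventually_exists_groundStates_succBox`) —
`E₀ < ⊤` eventually at low density (`stub_finiteEnergyLowDensity`, Ruelle's bound), transported to the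
index `N+1` along `N ↦ N+1 → ∞` and to `N` bodies in the LARGER box by Dirichlet monotonicity in the side
(`groundStateEnergy_anti`), then Rellich compactness of minimising sequences
(`stub_existsNonnegGroundState stub_compactness`). What remains of the kernel is exactly the influence bound.
-/

noncomputable section

open MeasureTheory Filter
open scoped ENNReal NNReal

namespace Summit.AtomisticToContinuum.BoseEinsteinCondensation.Theorems.SquareSummableInfluence

open Literature.MathematicalPhysics.QuantumManyBody.BoseGas
open Summit.AtomisticToContinuum.BoseEinsteinCondensation.Theorems.GroundStateRigidity

/-- A closed-form ground state exists whenever the ground-state energy is finite (Rellich compactness of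
a minimising sequence and the diamagnetic regularisation, `stub_existsNonnegGroundState stub_compactness`).
[cite: ReedSimonIV1978, §XIII.12 Thm XIII.46 and Thm XIII.64] -/
theorem exists_isGroundState_of_ne_top (N : ℕ) (v : ℝ → ℝ≥0∞) (L : ℝ)
    (hE : groundStateEnergy v N L ≠ ⊤) : ∃ Ψ₀ : Config N → ℂ, IsGroundState v L Ψ₀ := by
  obtain ⟨Ψ₀, -, h⟩ := stub_existsNonnegGroundState stub_compactness N v L hE
  exact ⟨fun X => (Ψ₀ X : ℂ), h⟩

/-- **The ground states of the physics kernel exist.** For every repulsive finite-range `v` there is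
`ρ₀ > 0` such that for `0 < ρ < ρ₀` and all large `N`, in the Dirichlet box of side `((N+1)/ρ)^{1/3}` both
the `N`-body and the `(N+1)`-body problem have a closed-form ground state (`IsGroundState`): finiteness of
`E₀` at low density eventually (`stub_finiteEnergyLowDensity`) at the index `N+1`, and for `N` bodies in the
larger box by monotonicity in the side (`groundStateEnergy_anti`); then `exists_isGroundState_of_ne_top`.
[cite: Ruelle1969, §3.5.11] -/
theorem eventually_exists_groundStates_succBox :
    ∀ v : ℝ → ℝ≥0∞, IsRepulsiveFiniteRange v →
      ∃ ρ₀ : ℝ, 0 < ρ₀ ∧ ∀ ρ : ℝ, 0 < ρ → ρ < ρ₀ → ∀ᶠ N : ℕ in atTop,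
        (∃ Θ₀ : Config N → ℂ, IsGroundState v (sideLength ρ (N + 1)) Θ₀) ∧
        (∃ Ψ₀ : Config (N + 1) → ℂ, IsGroundState v (sideLength ρ (N + 1)) Ψ₀) := by
  intro v hv
  obtain ⟨ρ₁, hρ₁, h₁⟩ := stub_finiteEnergyLowDensity v hv
  refine ⟨ρ₁, hρ₁, fun ρ hρ hρlt => ?_⟩
  have hN : ∀ᶠ N : ℕ in atTop, groundStateEnergy v N (sideLength ρ N) ≠ ⊤ := h₁ ρ hρ hρlt
  have hN1 : ∀ᶠ N : ℕ in atTop, groundStateEnergy v (N + 1) (sideLength ρ (N + 1)) ≠ ⊤ :=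
    (tendsto_add_atTop_nat 1).eventually hN
  filter_upwards [hN, hN1] with N hEN hEN1
  -- the boxes grow: `sideLength ρ N ≤ sideLength ρ (N+1)`
  have hLL : sideLength ρ N ≤ sideLength ρ (N + 1) := by
    unfold sideLength
    refine Real.rpow_le_rpow (div_nonneg N.cast_nonneg hρ.le)
      (div_le_div_of_nonneg_right ?_ hρ.le) (by norm_num)
    push_cast
    linarith
  refine ⟨exists_isGroundState_of_ne_top N v _ ?_, exists_isGroundState_of_ne_top (N + 1) v _ hEN1⟩
  exact ne_top_of_le_ne_top hEN (groundStateEnergy_anti v N hLL)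

end Summit.AtomisticToContinuum.BoseEinsteinCondensation.Theorems.SquareSummableInfluence

end
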